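import Summits.CriticalPhenomena.CardyFormulaZ2.Theorems.CardyComplexConeParafermionToSLESixFamiliesDiamondIdentifyArgs
import Summits.CriticalPhenomena.CardyFormulaZ2.Theorems.CardyComplexConeParafermionToSLESixFamiliesDiamondIdentifyReparam
import Summits.CriticalPhenomena.CardyFormulaZ2.Theorems.CardyComplexConeParafermionToSLESixFamiliesDiamondIdentifyCollinear
import Summits.CriticalPhenomena.CardyFormulaZ2.Theorems.CardyComplexConeParafermionToSLESixFamiliesDiamondIdentifyPieces
import Mathlib.Analysis.Convex.Topology
import HarnessLib

/-!
# Line `potential-darboux-picard-diamond`, stub S4′ (`stub_identifyPotentialPh`): univalence of the potential limit onto the interior of the limit polygon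

Helper file of the stub `stub_identifyPotentialPh` of crux `ParafermionToSLESixFamilies` (stmt-CriticalPhenomena-11389).
Step (iv) of the identification (THE ENGINE APPLIED): the potential limit `G` — continuous on the closed diamond,
holomorphic OR antiholomorphic inside (S3 b′), moving weakly monotonically along the left-turning directions `d_j` on
the pieces of the boundary chain (DIR/TURN in the limit), with a non-degenerate limit polygon `K` (interior point `w₀`
strictly left of every edge line) — is HOLOMORPHIC and maps the diamond CONFORMALLY ONTO `interior K`
(`conformal_of_boundaryTrace`, registered helper of the crux item). Proof: pull back by a Riemann map `R` with
Carathéodory extension `Φ` (`exists_riemannMap_extension`); the boundary correspondence `t ↦ Φ(e^{it})` runs once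
counter-clockwise around the convex frontier (`boundaryArg_of_injOn_sphere`, sign by `TraceWindingNonneg` applied to
`Φ`); matching its argument about the centre with the strictly increasing argument of the boundary loop
(`exists_loopArg`, `exists_monotone_reparam`) gives `Φ(e^{it}) = ℓ(λ t)` with `λ` continuous non-decreasing, so the
non-decreasing argument of the trace `G ∘ ℓ` (`exists_traceArg`) yields the boundary datum of `DarbouxPicardConvex` for
`G ∘ Φ`; in the antiholomorphic case `conj ∘ G ∘ Φ` would have winding `−1`, excluded by `TraceWindingNonneg`.
-/

noncomputable section

namespace Summit.CriticalPhenomena.CardyFormulaZ2.Cruxes.ParafermionToSLESixFamilies.PotentialDarbouxPicardDiamond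

open scoped Topology ComplexConjugate BigOperators
open Filter Set Metric Complex
open Literature.Probability.RandomPlanarGeometry

/-- Two polar representations of frontier points of a convex set about an interior point with arguments differing by
a multiple of `2π` represent the same point. -/
theorem eq_of_polar_of_angle_eq {K : Set ℂ} (hK : Convex ℝ K) {z₀ P Q : ℂ} (hz₀ : z₀ ∈ interior K)
    (hP : P ∈ frontier K) (hQ : Q ∈ frontier K) (hPz : P ≠ z₀) (hQz : Q ≠ z₀) {a b : ℝ}
    (hPa : P - z₀ = (‖P - z₀‖ : ℂ) * exp (a * I)) (hQb : Q - z₀ = (‖Q - z₀‖ : ℂ) * exp (b * I))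
    (hab : exp ((a : ℂ) * I) = exp ((b : ℂ) * I)) : P = Q := by
  have hn : 0 < ‖P - z₀‖ := norm_pos_iff.2 (sub_ne_zero.2 hPz)
  have hn' : 0 < ‖Q - z₀‖ := norm_pos_iff.2 (sub_ne_zero.2 hQz)
  have hA : (‖P - z₀‖ : ℂ) ≠ 0 := by exact_mod_cast hn.ne'
  refine eq_of_frontier_of_sameRay hK hz₀ hP hQ (div_pos hn' hn) ?_
  calc Q - z₀ = (‖Q - z₀‖ : ℂ) * exp (a * I) := by rw [hab]; exact hQb
    _ = ((‖Q - z₀‖ / ‖P - z₀‖ : ℝ) : ℂ) * ((‖P - z₀‖ : ℂ) * exp (a * I)) := by push_cast; field_simp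
    _ = ((‖Q - z₀‖ / ‖P - z₀‖ : ℝ) : ℂ) * (P - z₀) := by rw [← hPa]

/-- **Univalence of the potential limit onto the interior of the limit polygon.** -/
theorem conformal_of_boundaryTrace : DarbouxPicardConvex → TraceWindingNonneg → ∀ (D : DobrushinDomain) (N : ℕ) (ℓ : ℝ → ℂ) (t : ℕ → ℝ) (c w₀ : ℂ) (G : ℂ → ℂ) (d : ℕ → ℂ) (θ : ℕ → ℝ) (K : Set ℂ), 0 < N → c ∈ D.carrier → Convex ℝ D.carrier → Continuous ℓ → (∀ s : ℝ, ℓ (s + 2 * Real.pi) = ℓ s) → Set.range ℓ = frontier D.carrier → Set.InjOn ℓ (Set.Ico 0 (2 * Real.pi)) → t 0 = 0 → (∀ j, t j < t (j + 1)) → (∀ j, t (j + N) = t j + 2 * Real.pi) → (∀ j, IsBdrySegment D (ℓ (t j)) (ℓ (t (j + 1)))) → (∀ (j : ℕ) (s : ℝ), t j ≤ s → s ≤ t (j + 1) → ℓ s = ℓ (t j) + (((s - t j) / (t (j + 1) - t j) : ℝ) : ℂ) * (ℓ (t (j + 1)) - ℓ (t j))) → (∀ j, ((ℓ (t (j + 2))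 - ℓ (t (j + 1))) / (ℓ (t (j + 1)) - ℓ (t j))).arg = 0 ∨ ((ℓ (t (j + 2)) - ℓ (t (j + 1))) / (ℓ (t (j + 1)) - ℓ (t j))).arg = Real.pi / 2) → ∑ j ∈ Finset.range N, ((ℓ (t (j + 2)) - ℓ (t (j + 1))) / (ℓ (t (j + 1)) - ℓ (t j))).arg = 2 * Real.pi → ContinuousOn G (closure D.carrier) → (DifferentiableOn ℂ G D.carrier ∨ DifferentiableOn ℂ (fun z => (starRingEnd ℂ) (G z)) D.carrier) → d 0 ≠ 0 → (∀ j, d (j + 1) = d j * Complex.exp (θ j * Complex.I)) → (∀ j, 0 ≤ θ j ∧ θ j < Real.pi) → ∑ j ∈ Finset.range N, θ j = 2 * Real.pi → (∀ (j : ℕ) (s s' : ℝ), t j ≤ s → s ≤ s' → s' ≤ t (j + 1) → ∃ r : ℝ, 0 ≤ r ∧ G (ℓ s') - G (ℓ s) = r * d j) → IsCompact K → Convex ℝ K → w₀ ∈ interior K → (∀ z ∈ frontier D.carrier, G z ∈ frontier K) → (∀ j : ℕ, 0 < ((w₀ - G (ℓ (t j))) * (starRingEnd ℂ) (d j)).im)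 → DifferentiableOn ℂ G D.carrier ∧ Set.InjOn G D.carrier ∧ G '' D.carrier = interior K := by
  intro hDP hTW D N ℓ t c w₀ G d θ K hN hc hconvD hℓc hper hrange hinj ht0 htlt htper hseg haff harg hargsum hGc hGd hd0
    hd hθ hθsum hmono hKc hKconv hw₀ hGfr hleft
  have hπ := Real.pi_pos
  have h2π : (0:ℝ) < 2 * Real.pi := by positivity
  -- the closed carrier as the convex set of reference
  have hK'conv : Convex ℝ (closure D.carrier) := hconvD.closure
  have hcint : c ∈ interior (closure D.carrier) :=
    interior_mono subset_closure (by rw [D.isOpen.interior_eq]; exact hc)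
  have hfr_eq : frontier (closure D.carrier) = frontier D.carrier := by
    have hint : interior (closure D.carrier) = D.carrier := by
      rw [hconvD.interior_closure_eq_interior_of_nonempty_interior ⟨c, by rw [D.isOpen.interior_eq]; exact hc⟩,
        D.isOpen.interior_eq]
    rw [frontier, frontier, closure_closure, hint, D.isOpen.interior_eq]
  have hℓfrD : ∀ s, ℓ s ∈ frontier D.carrier := fun s => by rw [← hrange]; exact ⟨s, rfl⟩
  have hℓfr : ∀ s, ℓ s ∈ frontier (closure D.carrier) := fun s => by rw [hfr_eq]; exact hℓfrD s
  -- the two arguments about `c` and the argument of the trace about `w₀`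
  obtain ⟨Θ, hΘc, hΘm, hΘper, hΘpol⟩ := exists_loopArg D N ℓ t c (closure D.carrier) hN hc hℓc hper hinj ht0 htlt
    htper hseg haff harg hargsum hK'conv hcint hℓfr
  have hGℓc : ContinuousOn (fun s => G (ℓ s)) (Icc 0 (2 * Real.pi)) :=
    hGc.comp hℓc.continuousOn fun s _ => frontier_subset_closure (hℓfrD s)
  obtain ⟨ΘG, hΘGc, hΘGm, hΘGper, hΘGpol⟩ := exists_traceArg N ℓ t G w₀ d θ hN hper hGℓc ht0 htlt htper hd0 hd hθ
    hθsum hmono hleft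
  -- the Riemann map and its boundary argument
  obtain ⟨R, Φ, hΦc, hΦR, hbij, hsph⟩ := exists_riemannMap_extension D.toJordanDomain
  obtain ⟨θR, hθRc, hθRpol, hθRmono⟩ := boundaryArg_of_injOn_sphere (closure D.carrier) c Φ hK'conv hcint
    (hΦc.mono sphere_subset_closedBall) hsph.injOn (by rw [hfr_eq]; exact hsph.mapsTo)
  have hΦdiff : DifferentiableOn ℂ Φ (ball 0 1) := R.differentiableOn.congr fun z hz => hΦR hz
  have hwind := hTW Φ c θR hΦdiff hΦc hθRc (fun τ hτ => hθRpol τ hτ)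
  obtain ⟨hθRsm, hθR2π⟩ : StrictMonoOn θR (Icc 0 (2 * Real.pi)) ∧ θR (2 * Real.pi) = θR 0 + 2 * Real.pi := by
    rcases hθRmono with h | h
    · exact h
    · exfalso; linarith [h.2]
  -- the base point `Φ 1 = ℓ s₀`
  have h1sph : (1:ℂ) ∈ sphere (0:ℂ) 1 := by simp
  obtain ⟨s₁, hs₁⟩ : Φ 1 ∈ Set.range ℓ := by rw [hrange]; exact hsph.mapsTo h1sph
  obtain ⟨s₀, hs₀, n₀, -, hℓs₀⟩ := loop_reduce h2π hper s₁
  have hΦ1 : Φ 1 = ℓ s₀ := by rw [hℓs₀, hs₁]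
  have hs₀' : s₀ ∈ Icc 0 (4 * Real.pi) := ⟨hs₀.1, by linarith [hs₀.2]⟩
  -- compare the angles at the base point and shift `θR` by a multiple of `2π`
  have hexp1 : exp ((1 * 0 : ℝ) * I) = 1 := by simp
  obtain ⟨hne0, hpol0⟩ := hθRpol 0 ⟨le_rfl, h2π.le⟩
  rw [show ((0:ℝ) : ℂ) * I = 0 by simp, Complex.exp_zero] at hne0 hpol0
  obtain ⟨hℓne0, hℓpol0⟩ := hΘpol s₀ hs₀'
  have hexpeq : exp ((θR 0 : ℂ) * I) = exp ((Θ s₀ : ℂ) * I) := by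
    have hn : (‖Φ 1 - c‖ : ℂ) ≠ 0 := by exact_mod_cast (norm_pos_iff.2 (sub_ne_zero.2 hne0)).ne'
    have h1 : (‖Φ 1 - c‖ : ℂ) * exp ((θR 0 : ℂ) * I) = (‖Φ 1 - c‖ : ℂ) * exp ((Θ s₀ : ℂ) * I) := by
      calc (‖Φ 1 - c‖ : ℂ) * exp ((θR 0 : ℂ) * I) = Φ 1 - c := hpol0.symm
        _ = ℓ s₀ - c := by rw [hΦ1]
        _ = (‖ℓ s₀ - c‖ : ℂ) * exp ((Θ s₀ : ℂ) * I) := hℓpol0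
        _ = (‖Φ 1 - c‖ : ℂ) * exp ((Θ s₀ : ℂ) * I) := by rw [hΦ1]
    exact mul_left_cancel₀ hn h1
  obtain ⟨m, hm⟩ := exp_eq_exp_iff_exists_int.1 hexpeq
  have hm' : θR 0 = Θ s₀ + m * (2 * Real.pi) := by
    have h1 : ((θR 0 : ℝ) : ℂ) = ((Θ s₀ + m * (2 * Real.pi) : ℝ) : ℂ) := by
      apply mul_right_cancel₀ I_ne_zero
      rw [hm]; push_cast; ring
    exact_mod_cast h1
  set θR' : ℝ → ℝ := fun τ => θR τ - m * (2 * Real.pi) with hθR'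
  have hθR'0 : θR' 0 = Θ s₀ := by simp only [hθR']; linarith
  have hθR'c : ContinuousOn θR' (Icc 0 (2 * Real.pi)) := hθRc.sub continuousOn_const
  have hθR'm : MonotoneOn θR' (Icc 0 (2 * Real.pi)) := fun a ha b hb hab => by
    simp only [hθR']; linarith [hθRsm.monotoneOn ha hb hab]
  have hθR'pol : ∀ τ ∈ Icc (0:ℝ) (2 * Real.pi),
      Φ (exp (τ * I)) ≠ c ∧ Φ (exp (τ * I)) - c = (‖Φ (exp (τ * I)) - c‖ : ℂ) * exp (θR' τ * I) := by
    intro τ hτ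
    obtain ⟨hne, hpol⟩ := hθRpol τ hτ
    refine ⟨hne, ?_⟩
    set A : ℝ := ‖Φ (exp (τ * I)) - c‖ with hA
    rw [hpol]
    congr 1
    simp only [hθR']
    rw [show ((θR τ - m * (2 * Real.pi) : ℝ) : ℂ) * I = (θR τ : ℂ) * I + (-m : ℤ) * (2 * Real.pi * I) by
      push_cast; ring, Complex.exp_add, exp_int_mul_two_pi_mul_I, mul_one]
  have hθR'range : ∀ τ ∈ Icc (0:ℝ) (2 * Real.pi), θR' τ ∈ Icc (Θ 0) (Θ (4 * Real.pi)) := by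
    intro τ hτ
    have h1 : θR' 0 ≤ θR' τ := hθR'm ⟨le_rfl, h2π.le⟩ hτ hτ.1
    have h2 : θR' τ ≤ θR' (2 * Real.pi) := hθR'm hτ ⟨h2π.le, le_rfl⟩ hτ.2
    have h3 : θR' (2 * Real.pi) = Θ s₀ + 2 * Real.pi := by simp only [hθR']; rw [hθR2π]; linarith
    have h4 : Θ 0 ≤ Θ s₀ := hΘm.monotoneOn ⟨le_rfl, by positivity⟩ hs₀' hs₀.1
    have h5 : Θ (s₀ + 2 * Real.pi) ≤ Θ (4 * Real.pi) :=
      hΘm.monotoneOn ⟨by linarith [hs₀.1], by linarith [hs₀.2]⟩ ⟨by positivity, le_rfl⟩ (by linarith [hs₀.2])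
    rw [hΘper s₀ ⟨hs₀.1, hs₀.2.le⟩] at h5
    exact ⟨by linarith, by linarith⟩
  -- the reparametrisation `λ`
  obtain ⟨lam, hlamc, hlamm, hlamval, hlamuniq⟩ := exists_monotone_reparam Θ θR' (4 * Real.pi) (2 * Real.pi)
    (by positivity) h2π.le hΘc hΘm hθR'c hθR'm hθR'range
  have hlam0 : lam 0 = s₀ := hlamuniq 0 ⟨le_rfl, h2π.le⟩ s₀ hs₀' hθR'0
  have hlam2π : lam (2 * Real.pi) = s₀ + 2 * Real.pi := by
    refine hlamuniq _ ⟨h2π.le, le_rfl⟩ _ ⟨by linarith [hs₀.1], by linarith [hs₀.2]⟩ ?_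
    rw [hΘper s₀ ⟨hs₀.1, hs₀.2.le⟩, ← hθR'0]; simp only [hθR']; rw [hθR2π]; ring
  -- `ℓ ∘ λ` is the boundary correspondence
  have hℓlam : ∀ τ ∈ Icc (0:ℝ) (2 * Real.pi), ℓ (lam τ) = Φ (exp (τ * I)) := by
    intro τ hτ
    obtain ⟨hmem, hΘlam⟩ := hlamval τ hτ
    obtain ⟨hne1, hpol1⟩ := hΘpol (lam τ) hmem
    obtain ⟨hne2, hpol2⟩ := hθR'pol τ hτ
    have hsphτ : exp ((τ : ℂ) * I) ∈ sphere (0:ℂ) 1 := by rw [mem_sphere_zero_iff_norm, norm_exp_ofReal_mul_I]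
    exact eq_of_polar_of_angle_eq hK'conv hcint (hℓfr _) (by rw [hfr_eq]; exact hsph.mapsTo hsphτ) hne1 hne2 hpol1
      hpol2 (by rw [hΘlam])
  -- the boundary argument of `G ∘ Φ`
  set ϑ : ℝ → ℝ := fun τ => ΘG (lam τ) with hϑ
  have hϑc : ContinuousOn ϑ (Icc 0 (2 * Real.pi)) := hΘGc.comp hlamc fun τ hτ => (hlamval τ hτ).1
  have hϑm : MonotoneOn ϑ (Icc 0 (2 * Real.pi)) := fun a ha b hb hab =>
    hΘGm (hlamval a ha).1 (hlamval b hb).1 (hlamm ha hb hab)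
  have hϑ2π : ϑ (2 * Real.pi) = ϑ 0 + 2 * Real.pi := by
    simp only [hϑ]; rw [hlam2π, hlam0, hΘGper s₀ ⟨hs₀.1, hs₀.2.le⟩]
  have hbdry : ∀ τ ∈ Icc (0:ℝ) (2 * Real.pi), G (Φ (exp (τ * I))) ∈ frontier K ∧
      G (Φ (exp (τ * I))) - w₀ = (‖G (Φ (exp (τ * I))) - w₀‖ : ℂ) * exp (ϑ τ * I) := by
    intro τ hτ
    rw [← hℓlam τ hτ]
    exact ⟨hGfr _ (hℓfrD _), (hΘGpol (lam τ) (hlamval τ hτ).1).2⟩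
  have hFc : ContinuousOn (fun z => G (Φ z)) (closedBall 0 1) := hGc.comp hΦc hbij.mapsTo
  -- the two cases of (b′)
  rcases hGd with hG | hG
  · -- holomorphic: Darboux–Picard
    have hFd : DifferentiableOn ℂ (fun z => G (Φ z)) (ball 0 1) :=
      (hG.comp R.differentiableOn R.mapsTo).congr fun z hz => by simp only [Function.comp, hΦR hz]
    obtain ⟨hinjF, himF⟩ := hDP (fun z => G (Φ z)) K w₀ ϑ hKconv hKc hw₀ hFd hFc hϑm hϑc hϑ2π hbdry
    refine ⟨hG, fun x hx y hy hxy => ?_, ?_⟩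
    · obtain ⟨a, ha, rfl⟩ := R.bijOn.surjOn hx
      obtain ⟨b, hb, rfl⟩ := R.bijOn.surjOn hy
      have : a = b := hinjF ha hb (by simp only [hΦR ha, hΦR hb]; exact hxy)
      rw [this]
    · rw [← himF]
      apply Subset.antisymm
      · rintro _ ⟨x, hx, rfl⟩
        obtain ⟨a, ha, rfl⟩ := R.bijOn.surjOn hx
        exact ⟨a, ha, by simp only [hΦR ha]⟩
      · rintro _ ⟨a, ha, rfl⟩
        exact ⟨R a, R.mapsTo ha, by simp only [hΦR ha]⟩
  · -- antiholomorphic: the conjugate trace would wind backwards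
    exfalso
    have hFd : DifferentiableOn ℂ (fun z => conj (G (Φ z))) (ball 0 1) :=
      (hG.comp R.differentiableOn R.mapsTo).congr fun z hz => by simp only [Function.comp, hΦR hz]
    have hFc' : ContinuousOn (fun z => conj (G (Φ z))) (closedBall 0 1) := continuous_conj.comp_continuousOn hFc
    have hϑc' : ContinuousOn (fun τ => -ϑ τ) (Icc 0 (2 * Real.pi)) := hϑc.neg
    have hbdry' : ∀ τ ∈ Icc (0:ℝ) (2 * Real.pi), conj (G (Φ (exp (τ * I)))) ≠ conj w₀ ∧
        conj (G (Φ (exp (τ * I)))) - conj w₀ = (‖conj (G (Φ (exp (τ * I)))) - conj w₀‖ : ℂ) * exp ((-ϑ τ : ℝ) * I) := by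
      intro τ hτ
      obtain ⟨hfrK, hpol⟩ := hbdry τ hτ
      have hne : G (Φ (exp (τ * I))) ≠ w₀ := ((disjoint_interior_frontier (s := K)).ne_of_mem hw₀ hfrK).symm
      refine ⟨fun h => hne (by simpa using congrArg conj h), ?_⟩
      have e1 : conj (G (Φ (exp (τ * I)))) - conj w₀ = conj (G (Φ (exp (τ * I))) - w₀) := by rw [map_sub]
      rw [e1, norm_conj]
      set A : ℝ := ‖G (Φ (exp (τ * I))) - w₀‖ with hA
      rw [hpol, map_mul, conj_ofReal, ← exp_conj, map_mul, conj_ofReal, conj_I]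
      congr 1; congr 1; push_cast; ring
    have := hTW (fun z => conj (G (Φ z))) (conj w₀) (fun τ => -ϑ τ) hFd hFc' hϑc' hbdry'
    linarith

end Summit.CriticalPhenomena.CardyFormulaZ2.Cruxes.ParafermionToSLESixFamilies.PotentialDarbouxPicardDiamond

end
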